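import Literature.Algebra.Polynomial.CasasAlvero.CharEleven
import HarnessLib

/-!
# Casas-Alvero in degree 11 fails in characteristic 13

Explicit prime-field-rational Casas-Alvero polynomials of degree 11 in the depressed normal form
`X^11 + c_9 X^9 + ... + c_1 X` with prime-field witnesses, found by random sampling of the normal form over `F_13` (`dgen/rsearch.py` of the seat-2 g4 packet:
6 hits in 4.6·10^6 samples; a hit = an `f` of this shape whose Hasse derivatives `H_1 f, …, H_10 f` each vanish at an
`F_13`-rational root of `f`).  Consequence (with `CharThirteen.lean`): in characteristic 13 the only undecided Casas-Alvero digit is 5.  Each refutes `CA_11` over EVERY field of that characteristic.  [folklore]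
-/

noncomputable section

open Polynomial

namespace Literature.Algebra.Polynomial.CasasAlvero

variable (K : Type*) [Field K]


/-- the depressed degree-11 normal form `X^11 + c_9 X^9 + … + c_1 X`. [folklore] -/
def nf11 (c9 c8 c7 c6 c5 c4 c3 c2 c1 : K) : K[X] := X ^ 11 + (c9 • X ^ 9 + c8 • X ^ 8 + c7 • X ^ 7 + c6 • X ^ 6 + c5 • X ^ 5 + c4 • X ^ 4 + c3 • X ^ 3 + c2 • X ^ 2 + c1 • X ^ 1)

/-- the lower-order part has degree ≤ 9. [folklore] -/
theorem natDegree_nf11_tail_le (c9 c8 c7 c6 c5 c4 c3 c2 c1 : K) : (c9 • (X : K[X]) ^ 9 + c8 • X ^ 8 + c7 • X ^ 7 + c6 • X ^ 6 + c5 • X ^ 5 + c4 • X ^ 4 + c3 • X ^ 3 + c2 • X ^ 2 + c1 • X ^ 1).natDegree ≤ 9 := by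
  compute_degree

/-- its degree is 11. [folklore] -/
theorem natDegree_nf11 (c9 c8 c7 c6 c5 c4 c3 c2 c1 : K) : (nf11 K c9 c8 c7 c6 c5 c4 c3 c2 c1).natDegree = 11 := by
  have h := natDegree_nf11_tail_le K c9 c8 c7 c6 c5 c4 c3 c2 c1
  unfold nf11
  rw [natDegree_add_eq_left_of_natDegree_lt (by rw [natDegree_X_pow]; omega), natDegree_X_pow]

/-- it is monic. [folklore] -/
theorem monic_nf11 (c9 c8 c7 c6 c5 c4 c3 c2 c1 : K) : (nf11 K c9 c8 c7 c6 c5 c4 c3 c2 c1).Monic := by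
  have h := natDegree_nf11_tail_le K c9 c8 c7 c6 c5 c4 c3 c2 c1
  unfold nf11
  apply (monic_X_pow 11).add_of_left
  refine lt_of_le_of_lt (degree_le_of_natDegree_le h) ?_
  rw [degree_X_pow]; exact_mod_cast (by norm_num : (9 : ℕ) < 11)

/-- a polynomial in this normal form that is a pure power `(X - w)^11` has `w = 0` (evaluate at `0`). [folklore] -/
theorem eq_zero_of_nf11_eq_pow {c9 c8 c7 c6 c5 c4 c3 c2 c1 w : K} (h : nf11 K c9 c8 c7 c6 c5 c4 c3 c2 c1 = (X - C w) ^ 11) : w = 0 := by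
  have h0 := congrArg (eval 0) h
  simp only [nf11, eval_add, eval_pow, eval_X, eval_sub, eval_C, zero_sub, eval_smul, smul_eq_mul] at h0
  norm_num at h0
  first
    | exact h0
    | exact h0.symm
    | exact neg_eq_zero.mp h0
    | exact neg_eq_zero.mp h0.symm
    | exact (pow_eq_zero_iff (by norm_num)).mp h0.symm
    | exact neg_eq_zero.mp ((pow_eq_zero_iff (by norm_num)).mp h0.symm)

/-- a Casas-Alvero polynomial in this normal form with `c_9 + … + c_1 ≠ 0` (so it is not `X^11`) refutes `CA_11` over `K`. [folklore] -/
theorem not_holdsInDegree_eleven_of_nf11 {c9 c8 c7 c6 c5 c4 c3 c2 c1 : K} (hCA : IsCasasAlvero (nf11 K c9 c8 c7 c6 c5 c4 c3 c2 c1))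
    (hsum : c9 + c8 + c7 + c6 + c5 + c4 + c3 + c2 + c1 ≠ 0) : ¬ HoldsInDegree K 11 := by
  intro h
  obtain ⟨w, hw⟩ := h _ (monic_nf11 K _ _ _ _ _ _ _ _ _) (natDegree_nf11 K _ _ _ _ _ _ _ _ _) hCA
  have hw0 := eq_zero_of_nf11_eq_pow K hw
  subst hw0
  have h1 := congrArg (eval 1) hw
  simp only [nf11, eval_add, eval_pow, eval_X, map_zero, sub_zero, one_pow, eval_smul, smul_eq_mul, mul_one] at h1
  exact hsum (by linear_combination h1)

section Char13
variable [CharP K 13]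

/-- `X^11 + (-6) X^7 + (4) X^5 + (1) X^4 + (-3) X^2` is Casas-Alvero in characteristic 13 (witness roots H1↦0, H2↦-2, H3↦0, H4↦-2, H5↦-2, H6↦0, H7↦4, H8↦0, H9↦0, H10↦0). [folklore] -/
theorem isCasasAlvero_nf11_char_13 : IsCasasAlvero (nf11 K (0) (0) (-6) (0) (4) (1) (0) (-3) (0)) := by
  have hp : (13 : K) = 0 := by simpa using CharP.cast_eq_zero K 13
  intro i hi0 hi
  rw [natDegree_nf11] at hi
  unfold nf11
  interval_cases i
  · refine ⟨(0 : K), ?_, ?_⟩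
    · simp only [eval_add, eval_pow, eval_X, eval_smul, smul_eq_mul]
      linear_combination (0 : K) * hp
    · simp only [map_add, map_smul, hasseDeriv_X_pow, eval_add, eval_mul, eval_C, eval_pow, eval_X, eval_smul, smul_eq_mul,
        show Nat.choose 11 1 = 11 from rfl, show Nat.choose 9 1 = 9 from rfl, show Nat.choose 8 1 = 8 from rfl, show Nat.choose 7 1 = 7 from rfl, show Nat.choose 6 1 = 6 from rfl, show Nat.choose 5 1 = 5 from rfl, show Nat.choose 4 1 = 4 from rfl, show Nat.choose 3 1 = 3 from rfl, show Nat.choose 2 1 = 2 from rfl, show Nat.choose 1 1 = 1 from rfl]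
      push_cast
      linear_combination (0 : K) * hp
  · refine ⟨(-2 : K), ?_, ?_⟩
    · simp only [eval_add, eval_pow, eval_X, eval_smul, smul_eq_mul]
      linear_combination (-108 : K) * hp
    · simp only [map_add, map_smul, hasseDeriv_X_pow, eval_add, eval_mul, eval_C, eval_pow, eval_X, eval_smul, smul_eq_mul,
        show Nat.choose 11 2 = 55 from rfl, show Nat.choose 9 2 = 36 from rfl, show Nat.choose 8 2 = 28 from rfl, show Nat.choose 7 2 = 21 from rfl, show Nat.choose 6 2 = 15 from rfl, show Nat.choose 5 2 = 10 from rfl, show Nat.choose 4 2 = 6 from rfl, show Nat.choose 3 2 = 3 from rfl, show Nat.choose 2 2 = 1 from rfl, show Nat.choose 1 2 = 0 from rfl]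
      push_cast
      linear_combination (-1879 : K) * hp
  · refine ⟨(0 : K), ?_, ?_⟩
    · simp only [eval_add, eval_pow, eval_X, eval_smul, smul_eq_mul]
      linear_combination (0 : K) * hp
    · simp only [map_add, map_smul, hasseDeriv_X_pow, eval_add, eval_mul, eval_C, eval_pow, eval_X, eval_smul, smul_eq_mul,
        show Nat.choose 11 3 = 165 from rfl, show Nat.choose 9 3 = 84 from rfl, show Nat.choose 8 3 = 56 from rfl, show Nat.choose 7 3 = 35 from rfl, show Nat.choose 6 3 = 20 from rfl, show Nat.choose 5 3 = 10 from rfl, show Nat.choose 4 3 = 4 from rfl, show Nat.choose 3 3 = 1 from rfl, show Nat.choose 2 3 = 0 from rfl, show Nat.choose 1 3 = 0 from rfl]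
      push_cast
      linear_combination (0 : K) * hp
  · refine ⟨(-2 : K), ?_, ?_⟩
    · simp only [eval_add, eval_pow, eval_X, eval_smul, smul_eq_mul]
      linear_combination (-108 : K) * hp
    · simp only [map_add, map_smul, hasseDeriv_X_pow, eval_add, eval_mul, eval_C, eval_pow, eval_X, eval_smul, smul_eq_mul,
        show Nat.choose 11 4 = 330 from rfl, show Nat.choose 9 4 = 126 from rfl, show Nat.choose 8 4 = 70 from rfl, show Nat.choose 7 4 = 35 from rfl, show Nat.choose 6 4 = 15 from rfl, show Nat.choose 5 4 = 5 from rfl, show Nat.choose 4 4 = 1 from rfl, show Nat.choose 3 4 = 0 from rfl, show Nat.choose 2 4 = 0 from rfl, show Nat.choose 1 4 = 0 from rfl]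
      push_cast
      linear_combination (-3123 : K) * hp
  · refine ⟨(-2 : K), ?_, ?_⟩
    · simp only [eval_add, eval_pow, eval_X, eval_smul, smul_eq_mul]
      linear_combination (-108 : K) * hp
    · simp only [map_add, map_smul, hasseDeriv_X_pow, eval_add, eval_mul, eval_C, eval_pow, eval_X, eval_smul, smul_eq_mul,
        show Nat.choose 11 5 = 462 from rfl, show Nat.choose 9 5 = 126 from rfl, show Nat.choose 8 5 = 56 from rfl, show Nat.choose 7 5 = 21 from rfl, show Nat.choose 6 5 = 6 from rfl, show Nat.choose 5 5 = 1 from rfl, show Nat.choose 4 5 = 0 from rfl, show Nat.choose 3 5 = 0 from rfl, show Nat.choose 2 5 = 0 from rfl, show Nat.choose 1 5 = 0 from rfl]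
      push_cast
      linear_combination (2236 : K) * hp
  · refine ⟨(0 : K), ?_, ?_⟩
    · simp only [eval_add, eval_pow, eval_X, eval_smul, smul_eq_mul]
      linear_combination (0 : K) * hp
    · simp only [map_add, map_smul, hasseDeriv_X_pow, eval_add, eval_mul, eval_C, eval_pow, eval_X, eval_smul, smul_eq_mul,
        show Nat.choose 11 6 = 462 from rfl, show Nat.choose 9 6 = 84 from rfl, show Nat.choose 8 6 = 28 from rfl, show Nat.choose 7 6 = 7 from rfl, show Nat.choose 6 6 = 1 from rfl, show Nat.choose 5 6 = 0 from rfl, show Nat.choose 4 6 = 0 from rfl, show Nat.choose 3 6 = 0 from rfl, show Nat.choose 2 6 = 0 from rfl, show Nat.choose 1 6 = 0 from rfl]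
      push_cast
      linear_combination (0 : K) * hp
  · refine ⟨(4 : K), ?_, ?_⟩
    · simp only [eval_add, eval_pow, eval_X, eval_smul, smul_eq_mul]
      linear_combination (315408 : K) * hp
    · simp only [map_add, map_smul, hasseDeriv_X_pow, eval_add, eval_mul, eval_C, eval_pow, eval_X, eval_smul, smul_eq_mul,
        show Nat.choose 11 7 = 330 from rfl, show Nat.choose 9 7 = 36 from rfl, show Nat.choose 8 7 = 8 from rfl, show Nat.choose 7 7 = 1 from rfl, show Nat.choose 6 7 = 0 from rfl, show Nat.choose 5 7 = 0 from rfl, show Nat.choose 4 7 = 0 from rfl, show Nat.choose 3 7 = 0 from rfl, show Nat.choose 2 7 = 0 from rfl, show Nat.choose 1 7 = 0 from rfl]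
      push_cast
      linear_combination (6498 : K) * hp
  · refine ⟨(0 : K), ?_, ?_⟩
    · simp only [eval_add, eval_pow, eval_X, eval_smul, smul_eq_mul]
      linear_combination (0 : K) * hp
    · simp only [map_add, map_smul, hasseDeriv_X_pow, eval_add, eval_mul, eval_C, eval_pow, eval_X, eval_smul, smul_eq_mul,
        show Nat.choose 11 8 = 165 from rfl, show Nat.choose 9 8 = 9 from rfl, show Nat.choose 8 8 = 1 from rfl, show Nat.choose 7 8 = 0 from rfl, show Nat.choose 6 8 = 0 from rfl, show Nat.choose 5 8 = 0 from rfl, show Nat.choose 4 8 = 0 from rfl, show Nat.choose 3 8 = 0 from rfl, show Nat.choose 2 8 = 0 from rfl, show Nat.choose 1 8 = 0 from rfl]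
      push_cast
      linear_combination (0 : K) * hp
  · refine ⟨(0 : K), ?_, ?_⟩
    · simp only [eval_add, eval_pow, eval_X, eval_smul, smul_eq_mul]
      linear_combination (0 : K) * hp
    · simp only [map_add, map_smul, hasseDeriv_X_pow, eval_add, eval_mul, eval_C, eval_pow, eval_X, eval_smul, smul_eq_mul,
        show Nat.choose 11 9 = 55 from rfl, show Nat.choose 9 9 = 1 from rfl, show Nat.choose 8 9 = 0 from rfl, show Nat.choose 7 9 = 0 from rfl, show Nat.choose 6 9 = 0 from rfl, show Nat.choose 5 9 = 0 from rfl, show Nat.choose 4 9 = 0 from rfl, show Nat.choose 3 9 = 0 from rfl, show Nat.choose 2 9 = 0 from rfl, show Nat.choose 1 9 = 0 from rfl]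
      push_cast
      linear_combination (0 : K) * hp
  · refine ⟨(0 : K), ?_, ?_⟩
    · simp only [eval_add, eval_pow, eval_X, eval_smul, smul_eq_mul]
      linear_combination (0 : K) * hp
    · simp only [map_add, map_smul, hasseDeriv_X_pow, eval_add, eval_mul, eval_C, eval_pow, eval_X, eval_smul, smul_eq_mul,
        show Nat.choose 11 10 = 11 from rfl, show Nat.choose 9 10 = 0 from rfl, show Nat.choose 8 10 = 0 from rfl, show Nat.choose 7 10 = 0 from rfl, show Nat.choose 6 10 = 0 from rfl, show Nat.choose 5 10 = 0 from rfl, show Nat.choose 4 10 = 0 from rfl, show Nat.choose 3 10 = 0 from rfl, show Nat.choose 2 10 = 0 from rfl, show Nat.choose 1 10 = 0 from rfl]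
      push_cast
      linear_combination (0 : K) * hp

end Char13

/-- `CA_11` FAILS over every field of characteristic `13`. [folklore] -/
theorem not_holdsInDegree_eleven_of_char_13 [CharP K 13] : ¬ HoldsInDegree K 11 := by
  have hq : (13 : K) = 0 := by simpa using CharP.cast_eq_zero K 13
  exact not_holdsInDegree_eleven_of_nf11 K (isCasasAlvero_nf11_char_13 K)
    (fun h => one_ne_zero (by linear_combination (3 : K) * h - (-1 : K) * hq : (1 : K) = 0))

end Literature.Algebra.Polynomial.CasasAlvero
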